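import Summits.QuantumFields.BalabanUV.Beta.EriceRemainderEnclosureHistoryAutonomyComparisonAgeCompositionStaticChainFluidDomination

/-!
# EriceRemainderEnclosureHistoryAutonomyComparisonAgeCompositionStaticChainBlockFluid — (E74c) THE BLOCK FLUID MAJORANT OF THE STATIC CHAIN: a block of consecutive
# members of (E72a)'s chain, re-indexed into (E73a)'s spike letters, is dominated by the closed-form fluid and CLOSES member by member; the data handed to the next
# block (far ratios × E_L, own mass E_L − 1, next far load) — the single step of the bin chain AS A THEOREM

Cell `pub-balaban`, β-function sub-cell, BINDER row D4 «RemainderConst leaves for Bałaban's split» (`HOME/BINDER-OWNERS.md`; owner lineage `b2b-balaban-beta-an4`;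
this file by co-owner #2 lineage `b2b-balaban-beta-d4-p2`, generation 65), β-FLOW TEAM duty (1), FREEZE (0) honoured (def-free; imports (E73a) `…StaticChainFluidDomination`
(hence (E72a), (E72e)) and uses `beta_closed_form`, `sum_rho_mul_compounding`, `spike_step_le`, `spike_le_closed_form`, `q_mono`, `compounding_succ`, `consumed_mono`
BY NAME; nothing restated).

HONEST FRAMING (page 1, verbatim and binding).  *"Discharging BetaPertH makes Bałaban's UV stability UNCONDITIONAL — a real constructive-QFT result; it is
NOT the continuum limit and NOT the Clay problem."*  THIS FILE DISCHARGES NOTHING OF THE KIND.  Finite-sum algebra over sequences of real numbers — hypotheses of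
a census, not facts; the form, signs, ages and moments of Bałaban's (1.22) limit functional are NOT PRINTED ([I] p. 298; GAPS G-t4-U2-1∕-2) and NOT asserted.  Row D4
class UNCHANGED (critical-path width 0; instance 0∕1; D4 DISCHARGE NO DATE).  HONEST DEPENDENCY: continuum YM on T⁴ ⇐ BetaPertH ∧ nine spine estimates (0/9 proved);
BetaPertH ⇐ (D1) ∧ (D4) ∧ CAP+tail; G-an2-4 gates asym, D1 and NE2/3/4.

THE POINT (census sense (α); route (N); READMEs `g64/e73` §4 and `g65/e74` §4–§6 — «the bin-chain majorant as a theorem», successor item (2) of g65).  (E73a) proved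
FLUID DOMINATION for an abstract discrete spike in LOCAL letters (`ρ_m ≤ h_m(a + θE_m)∕(D₀ − κt_m)`, `E_{m+1} = E_m∕(1−ρ_m)`) and `spike_step_le` derived that step
inequality from a ratio of the shape `x_m(1 + L^far_m + Σ_{i<m} θ_{m,i}ρ_iΠ_{i≤j<m}(1−ρ_j)⁻¹)∕(1 − Ω_m)`.  THIS FILE connects them to the GLOBAL static chain of (E72a)
(`ρ_m = x_m(1 + Σ_{i<m} θ_{m,i} b_{m,i})∕(1−Ω_m)`, `b_{m+1,m} = ρ_m∕(1−ρ_m)`, `b_{m+1,i} = b_{m,i}∕(1−ρ_m)`): §1 RE-INDEXING — **`carried_far_factor`** (`b_{B+m,i} =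
b_{B,i}·Π_{j<m}(1−ρ_{B+j})⁻¹` for far ages `i < B`), **`block_beta_reindex`** (`b_{B+m,B+i'} = ρ_{B+i'}Π_{j'∈[i',m)}(1−ρ_{B+j'})⁻¹`), **`ratio_block_form`** (the
member's ratio in `spike_step_le`'s shape with `L^far_m = Σ_{i<B} θ_{B+m,i} b_{B+m,i}`), **`far_load_le`** (`L^far_m ≤ (Σ_{i<B} Θ_i b_{B,i})·Π_{j<m}(1−ρ_{B+j})⁻¹`
for defect bounds `Θ_i` and `b_{B,i} ≥ 0` — the far load inside the block is COMPOUNDED, g64's bookkeeping correction, now a lemma); §2 **`block_le_closed_form`** —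
THE BLOCK FLUID MAJORANT: for a block `B, …, B+L−1` with mutual defects `≤ θ_in < 1`, far defects `≤ Θ`, `Σ Θ_i b_{B,i} ≤ Λ`, window masses `1 − Ω_{B+m} ≥ D₀ − κt_m`
(`t_m` = load consumed inside the block; `0 ≤ κ ≤ κ'`, `1 − θ_in ≤ κ'`), a priori non-negative ratios, and (E72e)'s closed form with `a = 1 − θ_in`, `θ = θ_in + Λ`
ALIVE at the block's total load: (i) `E_m ≤ a·q(t_m)∕(1 − θq(t_m))` and **every member closes, `ρ_{B+m} < 1`** (member by member: the closure of the earlier members,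
from `spike_le_closed_form` at their consumed load, feeds `spike_step_le` for the next); (ii) `b_{B+L,i} = b_{B,i}·E_L` (far); (iii) `Σ_{i<L} b_{B+L,B+i} = E_L − 1`
(own mass); §3 **`block_carried_nonneg`**, **`next_far_load_le`** (`Σ_{i<B+L} Θ'_i b_{B+L,i} ≤ (Σ_{i<B} Θ'_i b_{B,i})·E_L + Θ'_blk(E_L − 1)`: the next block's `Λ'`).
Iterated over ratio bins oldest → youngest with worst-pair constants (`Θ`, `θ_in = θ̄(1)`, `Ω`-data by (E72c) `thetabar_antitone` and (E74b); window-mass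
constants `κ = κ' = 1` by (E74a)) this IS the bin-chain majorant whose outer-budget version is finite and closing numerically (README g65/e74 §4: `Φ_T 0.20–0.28`,
`Φ_ρ 0.70–0.77`).  §4 (appended, same generation): `block_sum_far_factor` and **`bin_chain`** — THE ITERATION PACKAGED: blocks `[Bd β, Bd(β+1))`, per-block
majorant values `F β ≥ 1` (each discharged by `block_le_closed_form`), block-constant defect bounds `Θ̄ β β' ≥ 0` and budgets `Λ β` dominating the MAJORANT
recursion `Σ_{β'<β} Θ̄ β β'(F β' − 1)Π_{β'<β''<β}F β''` ⟹ every member of every block closes and, at the start of every block, each earlier block's carried mass is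
`≤ (F β' − 1)Π_{β'<β''<β} F β''` (all carried ratios ≥ 0).  §5 (appended): **`young_read_out_le`** — the young age's chain load read block-constantly off
`bin_chain`'s masses: `Σ_{i<M} θz_i b_{M,i} ≤ Σ_{β'} ϑ β'(F β' − 1)Π F β''`.  §6 (appended): `window_mass_block_le` ∕ `window_mass_block_hyp` — the
`hΩ` hypothesis of `block_le_closed_form` for the WINDOW-MASS chain of (E74a) (`D₀ = 1 −` incoming far window mass at the block's oldest age, `κ = 1`).  NOT CLAIMED: the young's Abel sum over bins ((E73b) `near_load_le_abel_fluid` does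
it); any certified supremum; the static closure; MONO; (E58′); anything nonlinear; anything printed.
-/
noncomputable section
open Finset

namespace Summit.QuantumFields.BalabanUV.Beta.EriceRemainderEnclosureHistoryAutonomyComparisonAgeCompositionStaticChainBlockFluid

open Summit.QuantumFields.BalabanUV.Beta.EriceRemainderEnclosureHistoryAutonomyComparisonAgeCompositionStaticChain
  (beta_closed_form sum_rho_mul_compounding)
open Summit.QuantumFields.BalabanUV.Beta.EriceRemainderEnclosureHistoryAutonomyComparisonAgeCompositionStaticChainFluidDomination
  (spike_step_le spike_le_closed_form q_mono compounding_succ consumed_mono)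

/-! ## §1 Re-indexing a block of consecutive members of the static chain -/

/-- **FAR CARRIED RATIOS FACTOR THROUGH THE BLOCK'S COMPOUNDING.**  In the static chain (`b_{m+1,i} = b_{m,i}∕(1−ρ_m)` for `i < m`), an age `i` older than the
block starting at index `B` is carried through the first `m` block members as `b_{B+m,i} = b_{B,i}·Π_{j<m}(1−ρ_{B+j})⁻¹`. [folklore] -/
theorem carried_far_factor {ρ : ℕ → ℝ} {b : ℕ → ℕ → ℝ}
    (hold : ∀ m i, i < m → b (m + 1) i = b m i / (1 - ρ m)) (B : ℕ) {i : ℕ} (hi : i < B) :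
    ∀ m, b (B + m) i = b B i * ∏ j ∈ range m, (1 - ρ (B + j))⁻¹ := by
  intro m
  induction m with
  | zero => simp
  | succ m ih =>
    rw [show B + (m + 1) = (B + m) + 1 by ring, hold (B + m) i (by omega), ih, prod_range_succ, div_eq_mul_inv]
    ring

/-- **BLOCK-LOCAL CLOSED FORM.**  For block members `B+i' < B+m`: `b_{B+m,B+i'} = ρ_{B+i'}·Π_{j'∈[i',m)}(1−ρ_{B+j'})⁻¹` ((E72a) `beta_closed_form`, re-indexed). [folklore] -/
theorem block_beta_reindex {ρ : ℕ → ℝ} {b : ℕ → ℕ → ℝ}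
    (hnew : ∀ m, b (m + 1) m = ρ m / (1 - ρ m))
    (hold : ∀ m i, i < m → b (m + 1) i = b m i / (1 - ρ m)) (B : ℕ) {i' m : ℕ} (hi' : i' < m) :
    b (B + m) (B + i') = ρ (B + i') * ∏ j ∈ Ico i' m, (1 - ρ (B + j))⁻¹ := by
  rw [beta_closed_form hnew hold (B + m) (B + i') (by omega), prod_Ico_add (fun j => (1 - ρ j)⁻¹) i' m B,
    add_comm i' B, add_comm m B]

/-- **THE BLOCK FORM OF A MEMBER'S RATIO.**  The static-chain ratio `ρ_{B+m} = x_{B+m}(1 + Σ_{i<B+m} θ_{B+m,i} b_{B+m,i})∕(1 − Ω_{B+m})` splits into the FAR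
part `L^far_m = Σ_{i<B} θ_{B+m,i} b_{B+m,i}` and the block part in local closed form — exactly the shape `hρm` of (E73a) `spike_step_le`. [folklore] -/
theorem ratio_block_form {ρ x Ω : ℕ → ℝ} {θ b : ℕ → ℕ → ℝ}
    (hρ : ∀ m, ρ m = x m * (1 + ∑ i ∈ range m, θ m i * b m i) / (1 - Ω m))
    (hnew : ∀ m, b (m + 1) m = ρ m / (1 - ρ m))
    (hold : ∀ m i, i < m → b (m + 1) i = b m i / (1 - ρ m)) (B m : ℕ) :
    ρ (B + m) = x (B + m) * (1 + (∑ i ∈ range B, θ (B + m) i * b (B + m) i) +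
      ∑ i' ∈ range m, θ (B + m) (B + i') * (ρ (B + i') * ∏ j ∈ Ico i' m, (1 - ρ (B + j))⁻¹)) / (1 - Ω (B + m)) := by
  have hsplit : ∑ i ∈ range (B + m), θ (B + m) i * b (B + m) i =
      ∑ i ∈ range B, θ (B + m) i * b (B + m) i + ∑ i ∈ Ico B (B + m), θ (B + m) i * b (B + m) i :=
    (sum_range_add_sum_Ico _ (Nat.le_add_right B m)).symm
  have hshift : ∑ i ∈ Ico B (B + m), θ (B + m) i * b (B + m) i = ∑ i' ∈ range m, θ (B + m) (B + i') * b (B + m) (B + i') := by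
    rw [range_eq_Ico, sum_Ico_add (fun i => θ (B + m) i * b (B + m) i) 0 m B, zero_add, add_comm m B]
  have hblock : ∀ i' ∈ range m, θ (B + m) (B + i') * b (B + m) (B + i') =
      θ (B + m) (B + i') * (ρ (B + i') * ∏ j ∈ Ico i' m, (1 - ρ (B + j))⁻¹) := fun i' hi' => by
    rw [block_beta_reindex hnew hold B (mem_range.mp hi')]
  rw [hρ (B + m), hsplit, hshift, sum_congr rfl hblock, add_assoc]

/-- **THE FAR LOAD SEEN INSIDE THE BLOCK IS COMPOUNDED AND BOUNDED BY THE WORST DEFECTS.**  With `Θ_i ≥ θ_{B+m,i}` for the far ages `i < B` (the oldest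
block member's defects are the largest, (E72c) `thetabar_antitone`) and non-negative carried ratios `b_{B,i} ≥ 0` entering the block:
`L^far_m = Σ_{i<B} θ_{B+m,i} b_{B+m,i} ≤ (Σ_{i<B} Θ_i b_{B,i})·Π_{j<m}(1−ρ_{B+j})⁻¹` — the hypothesis `hfar` of (E73a) `spike_step_le` with `Λ = Σ_{i<B} Θ_i b_{B,i}`.
[folklore] -/
theorem far_load_le {ρ : ℕ → ℝ} {θ b : ℕ → ℕ → ℝ} {Θ : ℕ → ℝ}
    (hold : ∀ m i, i < m → b (m + 1) i = b m i / (1 - ρ m)) (B m : ℕ)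
    (hΘ : ∀ i, i < B → θ (B + m) i ≤ Θ i) (hb0 : ∀ i, i < B → 0 ≤ b B i) (hρ1 : ∀ j, j < m → ρ (B + j) < 1) :
    ∑ i ∈ range B, θ (B + m) i * b (B + m) i ≤ (∑ i ∈ range B, Θ i * b B i) * ∏ j ∈ range m, (1 - ρ (B + j))⁻¹ := by
  have hP : 0 ≤ ∏ j ∈ range m, (1 - ρ (B + j))⁻¹ :=
    prod_nonneg fun j hj => inv_nonneg.mpr (by linarith [hρ1 j (mem_range.mp hj)])
  rw [sum_mul]
  refine sum_le_sum fun i hi => ?_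
  have hiB := mem_range.mp hi
  rw [carried_far_factor hold B hiB m, ← mul_assoc]
  exact mul_le_mul_of_nonneg_right (mul_le_mul_of_nonneg_right (hΘ i hiB) (hb0 i hiB)) hP

/-! ## §2 THE BLOCK FLUID MAJORANT: a block of the static chain under (E73a)'s closed form -/

/-- **THE BLOCK FLUID MAJORANT OF THE STATIC CHAIN.**  Static chain in (E72a)'s letters (`ρ_m = x_m(1 + Σ_{i<m} θ_{m,i} b_{m,i})∕(1 − Ω_m)`, carried-ratio
updates `hnew`∕`hold`), loads `x ≥ 0`.  A BLOCK = the `L` consecutive members `B, …, B+L−1` (oldest first) with: mutual defects `0 ≤ θ_{B+m,B+i} ≤ θ_in < 1`;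
defects towards the far ages `i < B` bounded by `Θ_i` and far carried ratios `b_{B,i} ≥ 0` with `Σ_{i<B} Θ_i b_{B,i} ≤ Λ`; window masses `1 − Ω_{B+m} ≥
D₀ − κ·t_m` where `t_m = Σ_{i<m} x_{B+i}` is the load consumed inside the block (`0 ≤ κ ≤ κ'`, `1 − θ_in ≤ κ'`); ratios a priori non-negative.  If (E72e)'s closed
form with `a = 1 − θ_in`, `θ = θ_in + Λ` is ALIVE at the block's total load (`D₀ − κ't_L > 0`, `θ·q(t_L) < 1`, `q(t) = e^{(a∕κ')(log D₀ − log(D₀ − κ't))}∕(a+θ)`),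
then: (i) for every `m ≤ L` the block's compounding `E_m = Π_{j<m}(1−ρ_{B+j})⁻¹ ≤ a·q(t_m)∕(1 − θ·q(t_m))` and every block member CLOSES, `ρ_{B+m} < 1`;
(ii) every far carried ratio leaves the block multiplied by `E_L`: `b_{B+L,i} = b_{B,i}·E_L`; (iii) the block's own carried mass is `Σ_{i<L} b_{B+L,B+i} =
E_L − 1`.  ((E73a) `spike_step_le` + `spike_le_closed_form`, member by member, the closure of earlier members feeding the step inequality of the next.)  This is the
single step of the BIN CHAIN of README g64/e73 §4 ∕ g65/e74 §4 as a theorem about the chain itself: iterate it over ratio bins oldest → youngest, with `Θ`, `θ_in`,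
`Λ`, `Ω`-data taken at the worst pair ((E72c) `thetabar_antitone`, (E74b)). [folklore] -/
theorem block_le_closed_form {ρ x Ω t : ℕ → ℝ} {θ b : ℕ → ℕ → ℝ} {Θ : ℕ → ℝ} {B L : ℕ} {θin Λ D0 κ κ' : ℝ}
    (hρ : ∀ m, ρ m = x m * (1 + ∑ i ∈ range m, θ m i * b m i) / (1 - Ω m))
    (hnew : ∀ m, b (m + 1) m = ρ m / (1 - ρ m))
    (hold : ∀ m i, i < m → b (m + 1) i = b m i / (1 - ρ m))
    (hx : ∀ m, 0 ≤ x (B + m)) (hρ0 : ∀ m, m < L → 0 ≤ ρ (B + m))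
    (hθin : ∀ m i, i < m → m < L → 0 ≤ θ (B + m) (B + i) ∧ θ (B + m) (B + i) ≤ θin) (hθin0 : 0 ≤ θin) (hθin1 : θin < 1)
    (hΘ : ∀ m i, m < L → i < B → θ (B + m) i ≤ Θ i) (hb0 : ∀ i, i < B → 0 ≤ b B i)
    (hΛ : ∑ i ∈ range B, Θ i * b B i ≤ Λ) (hΛ0 : 0 ≤ Λ)
    (ht0 : t 0 = 0) (ht : ∀ m, t (m + 1) = t m + x (B + m))
    (hΩ : ∀ m, m < L → D0 - κ * t m ≤ 1 - Ω (B + m)) (hκ0 : 0 ≤ κ) (hκκ' : κ ≤ κ') (haκ : 1 - θin ≤ κ')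
    (hDL : 0 < D0 - κ' * t L)
    (hqL : (θin + Λ) * (Real.exp ((1 - θin) / κ' * (Real.log D0 - Real.log (D0 - κ' * t L))) / ((1 - θin) + (θin + Λ))) < 1) :
    (∀ m, m ≤ L →
      (∏ j ∈ range m, (1 - ρ (B + j))⁻¹) ≤ (1 - θin) * (Real.exp ((1 - θin) / κ' * (Real.log D0 - Real.log (D0 - κ' * t m))) / ((1 - θin) + (θin + Λ))) /
        (1 - (θin + Λ) * (Real.exp ((1 - θin) / κ' * (Real.log D0 - Real.log (D0 - κ' * t m))) / ((1 - θin) + (θin + Λ))))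
      ∧ (m < L → ρ (B + m) < 1))
    ∧ (∀ i, i < B → b (B + L) i = b B i * ∏ j ∈ range L, (1 - ρ (B + j))⁻¹)
    ∧ (∑ i ∈ range L, b (B + L) (B + i) = (∏ j ∈ range L, (1 - ρ (B + j))⁻¹) - 1) := by
  -- local letters
  set ρ' : ℕ → ℝ := fun m => ρ (B + m) with hρ'def
  set h : ℕ → ℝ := fun m => x (B + m) with hhdef
  set E : ℕ → ℝ := fun m => ∏ j ∈ range m, (1 - ρ (B + j))⁻¹ with hEdef
  have hh : ∀ m, 0 ≤ h m := fun m => hx m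
  have hE0 : E 0 = 1 := by simp [hEdef]
  have hE : ∀ m, E (m + 1) = E m / (1 - ρ' m) := fun m => compounding_succ ρ' m
  have ha : 0 < 1 - θin := by linarith
  have hκ'0 : 0 ≤ κ' := hκ0.trans hκκ'
  have haθ : 0 < (1 - θin) + (θin + Λ) := by linarith
  -- consumed load is non-decreasing and non-negative
  have htmono : ∀ m n, m ≤ n → t m ≤ t n := fun m n hmn => consumed_mono hh ht hmn
  have ht00 : ∀ m, 0 ≤ t m := fun m => by rw [← ht0]; exact htmono 0 m (Nat.zero_le m)
  have hDm : ∀ m, m ≤ L → 0 < D0 - κ' * t m := fun m hm => by nlinarith [htmono m L hm]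
  have hDen : ∀ m, m ≤ L → 0 < D0 - κ * t m := fun m hm => by
    have := hDm m hm; nlinarith [ht00 m, htmono m L hm]
  have hqm : ∀ m, m ≤ L →
      (θin + Λ) * (Real.exp ((1 - θin) / κ' * (Real.log D0 - Real.log (D0 - κ' * t m))) / ((1 - θin) + (θin + Λ))) < 1 :=
    fun m hm => lt_of_le_of_lt (mul_le_mul_of_nonneg_left (q_mono ha.le hκ'0 haθ (htmono m L hm) hDL) (by linarith)) hqL
  -- the step inequalities, member by member
  have hS : ∀ n, n ≤ L → ∀ j, j < n → ρ' j ≤ h j * (((1 - θin) + (θin + Λ) * E j) / (D0 - κ * t j)) := by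
    intro n
    induction n with
    | zero => intro _ j hj; omega
    | succ n ih =>
      intro hn j hj
      have hn' : n < L := Nat.lt_of_succ_le hn
      have hSn := ih hn'.le
      rcases Nat.lt_succ_iff_lt_or_eq.mp hj with hjn | hjn
      · exact hSn j hjn
      · subst hjn
        -- closure of the earlier members from the closed form alive at t j
        have hcl := spike_le_closed_form (ρ := ρ') (h := h) (t := t) (E := E) ha haκ (by linarith) hκκ' hh ht0 ht hE0 hE hSn
          (hDm j hn'.le) (hqm j hn'.le)
        have hρ1 : ∀ i, i < j → ρ' i < 1 := fun i hi => (hcl i hi.le).2 hi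
        -- the step inequality of member j
        have hform := ratio_block_form hρ hnew hold B j
        have hstep := spike_step_le (x := fun m => x (B + m)) (ρ := ρ') (Ω := fun m => Ω (B + m)) (t := t)
          (Lfar := fun m => ∑ i ∈ range B, θ (B + m) i * b (B + m) i) (θm := fun m i => θ (B + m) (B + i))
          (θ := θin) (Λ := Λ) (D0 := D0) (κ := κ) (m := j)
          hform (hx j) (fun i hi => hρ0 i (hi.trans hn')) hρ1 (fun i hi => hθin j i hi hn') hθin0 hθin1.le hΛ0
          (le_trans (far_load_le hold B j (fun i hi => hΘ j i hn' hi) hb0 hρ1)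
            (mul_le_mul_of_nonneg_right hΛ (prod_nonneg fun i hi => inv_nonneg.mpr (by linarith [hρ1 i (mem_range.mp hi)]))))
          (hΩ j hn') (hDen j hn'.le)
        simpa [hhdef, hEdef] using hstep
  have hmain := spike_le_closed_form (ρ := ρ') (h := h) (t := t) (E := E) ha haκ (by linarith) hκκ' hh ht0 ht hE0 hE (hS L le_rfl) hDL hqL
  refine ⟨fun m hm => ⟨(hmain m hm).1, fun hmL => (hmain m hm).2 hmL⟩, fun i hi => carried_far_factor hold B hi L, ?_⟩
  -- the block's own carried mass
  have hρne : ∀ j, j < L → ρ' j ≠ 1 := fun j hj => ((hmain j hj.le).2 hj).ne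
  rw [← sum_rho_mul_compounding hρne]
  exact sum_congr rfl fun i hi => block_beta_reindex hnew hold B (mem_range.mp hi)

/-! ## §3 Handing the data to the next block -/

/-- **THE BLOCK'S OWN CARRIED RATIOS ARE NON-NEGATIVE** when its members' ratios lie in `[0,1)` (block-local closed form). [folklore] -/
theorem block_carried_nonneg {ρ : ℕ → ℝ} {b : ℕ → ℕ → ℝ}
    (hnew : ∀ m, b (m + 1) m = ρ m / (1 - ρ m))
    (hold : ∀ m i, i < m → b (m + 1) i = b m i / (1 - ρ m)) (B L : ℕ)
    (hρ0 : ∀ m, m < L → 0 ≤ ρ (B + m)) (hρ1 : ∀ m, m < L → ρ (B + m) < 1) :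
    ∀ i', i' < L → 0 ≤ b (B + L) (B + i') := by
  intro i' hi'
  rw [block_beta_reindex hnew hold B hi']
  exact mul_nonneg (hρ0 i' hi') (prod_nonneg fun j hj => inv_nonneg.mpr (by linarith [hρ1 j (mem_Ico.mp hj).2]))

/-- **THE NEXT BLOCK'S INCOMING FAR LOAD.**  After a block of length `L` at `B` (far ratios multiplied by `E_L`, own carried mass `E_L − 1` —
`block_le_closed_form` (ii)∕(iii)), the far load entering the NEXT block with defect bounds `Θ'` (constant `Θ'_blk` on the block just processed, worst pair) is
`Σ_{i<B+L} Θ'_i b_{B+L,i} ≤ (Σ_{i<B} Θ'_i b_{B,i})·E_L + Θ'_blk·(E_L − 1)` — the recursion `Λ' = Λ^{Θ'}_{old}·F + Θ'_blk(F − 1)` of the bin chain once `E_L ≤ F`.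
[folklore] -/
theorem next_far_load_le {b : ℕ → ℕ → ℝ} {Θ' : ℕ → ℝ} {B L : ℕ} {EL Θblk : ℝ}
    (hfar : ∀ i, i < B → b (B + L) i = b B i * EL) (hmass : ∑ i ∈ range L, b (B + L) (B + i) = EL - 1)
    (hΘblk : ∀ i', i' < L → Θ' (B + i') ≤ Θblk) (hb0 : ∀ i', i' < L → 0 ≤ b (B + L) (B + i')) :
    ∑ i ∈ range (B + L), Θ' i * b (B + L) i ≤ (∑ i ∈ range B, Θ' i * b B i) * EL + Θblk * (EL - 1) := by
  have hsplit : ∑ i ∈ range (B + L), Θ' i * b (B + L) i =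
      ∑ i ∈ range B, Θ' i * b (B + L) i + ∑ i ∈ Ico B (B + L), Θ' i * b (B + L) i :=
    (sum_range_add_sum_Ico _ (Nat.le_add_right B L)).symm
  have hshift : ∑ i ∈ Ico B (B + L), Θ' i * b (B + L) i = ∑ i' ∈ range L, Θ' (B + i') * b (B + L) (B + i') := by
    rw [range_eq_Ico, sum_Ico_add (fun i => Θ' i * b (B + L) i) 0 L B, zero_add, add_comm L B]
  have h1 : ∑ i ∈ range B, Θ' i * b (B + L) i = (∑ i ∈ range B, Θ' i * b B i) * EL := by
    rw [sum_mul]; exact sum_congr rfl fun i hi => by rw [hfar i (mem_range.mp hi), mul_assoc]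
  have h2 : ∑ i' ∈ range L, Θ' (B + i') * b (B + L) (B + i') ≤ Θblk * (EL - 1) := by
    rw [← hmass, mul_sum]
    exact sum_le_sum fun i' hi' => mul_le_mul_of_nonneg_right (hΘblk i' (mem_range.mp hi')) (hb0 i' (mem_range.mp hi'))
  rw [hsplit, hshift, h1]
  linarith

/-! ## §4 (appended, same generation) THE BIN CHAIN: iterating the block majorant over consecutive blocks -/

/-- Block sums of carried ratios factor through a later block's compounding: `Σ_{i∈blk} b_{B+m,i} = (Σ_{i∈blk} b_{B,i})·Π_{j<m}(1−ρ_{B+j})⁻¹` for a set of far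
ages `blk ⊆ [0,B)`. [folklore] -/
theorem block_sum_far_factor {ρ : ℕ → ℝ} {b : ℕ → ℕ → ℝ}
    (hold : ∀ m i, i < m → b (m + 1) i = b m i / (1 - ρ m)) (B m : ℕ) {s : Finset ℕ} (hs : ∀ i ∈ s, i < B) :
    ∑ i ∈ s, b (B + m) i = (∑ i ∈ s, b B i) * ∏ j ∈ range m, (1 - ρ (B + j))⁻¹ := by
  rw [sum_mul]
  exact sum_congr rfl fun i hi => carried_far_factor hold B (hs i hi) m

/-- **THE BIN CHAIN (iteration of the block majorant).**  Static chain (`hnew`, `hold`) cut into consecutive blocks `[Bd β, Bd (β+1))`, `β < n`, `Bd 0 = 0`, `Bd`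
non-decreasing.  Suppose each block `β` admits a majorant value `F β ≥ 1` in the following sense (`hstep`, discharged block by block by `block_le_closed_form` with
the closed form alive): WHENEVER the carried ratios entering the block are non-negative and the far load they produce with the block's defect bounds `Θ β ·`
is at most `Λ β`, every member of the block has ratio in `[0,1)` and the block's compounding is `≤ F β`.  Suppose the defect bounds are block-constant from
above, `Θ β i ≤ Θ̄ β β'` (`≥ 0`) for `i` in block `β' < β` (worst pair), and the budgets `Λ β` dominate the MAJORANT recursion: `Σ_{β'<β} Θ̄ β β'·(F β' − 1)·
Π_{β'<β''<β} F β'' ≤ Λ β`.  THEN every member of every block closes, and at the start of every block `β ≤ n` the carried mass of each earlier block `β'` is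
bounded by the majorant mass: `Σ_{i∈blk β'} b_{Bd β,i} ≤ (F β' − 1)·Π_{β'<β''<β} F β''` (with all carried ratios non-negative).  At `β = n` this bounds what the
young age below the window sees, block by block (multiply by the worst defect `θ̄(bottom of blk β'∕z)`, (E72c) `thetabar_antitone`).  This is README g64/e73 §4's
bin-chain majorant Φ as a theorem about the chain; its outer-budget version is finite and closing for the window-mass chain (README g65/e74 §4). [folklore] -/
theorem bin_chain {ρ : ℕ → ℝ} {b θfar : ℕ → ℕ → ℝ} {Bd : ℕ → ℕ} {n : ℕ} {F Λ : ℕ → ℝ} {Θbar : ℕ → ℕ → ℝ}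
    (hnew : ∀ m, b (m + 1) m = ρ m / (1 - ρ m))
    (hold : ∀ m i, i < m → b (m + 1) i = b m i / (1 - ρ m))
    (hBd0 : Bd 0 = 0) (hBd : ∀ β, Bd β ≤ Bd (β + 1)) (hF1 : ∀ β, 1 ≤ F β) (hΘbar0 : ∀ β β', 0 ≤ Θbar β β')
    (hΘ : ∀ β β' i, β' < β → Bd β' ≤ i → i < Bd (β' + 1) → θfar β i ≤ Θbar β β')
    (hΛ : ∀ β, β < n → ∑ β' ∈ range β, Θbar β β' * ((F β' - 1) * ∏ β'' ∈ Ico (β' + 1) β, F β'') ≤ Λ β)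
    (hstep : ∀ β, β < n → (∀ i, i < Bd β → 0 ≤ b (Bd β) i) →
      (∑ i ∈ range (Bd β), θfar β i * b (Bd β) i ≤ Λ β) →
      (∀ m, m < Bd (β + 1) - Bd β → 0 ≤ ρ (Bd β + m) ∧ ρ (Bd β + m) < 1) ∧
        (∏ j ∈ range (Bd (β + 1) - Bd β), (1 - ρ (Bd β + j))⁻¹) ≤ F β) :
    ∀ β, β ≤ n →
      (∀ i, i < Bd β → 0 ≤ b (Bd β) i) ∧
      (∀ β', β' < β → ∑ i ∈ Ico (Bd β') (Bd (β' + 1)), b (Bd β) i ≤ (F β' - 1) * ∏ β'' ∈ Ico (β' + 1) β, F β'') ∧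
      (∀ β', β' < β → ∀ m, m < Bd (β' + 1) - Bd β' → ρ (Bd β' + m) < 1) := by
  -- monotonicity of the block boundaries
  have hBdmono : ∀ β' β, β' ≤ β → Bd β' ≤ Bd β := fun β' β hle => monotone_nat_of_le_succ hBd hle
  intro β
  induction β with
  | zero =>
    intro _
    refine ⟨fun i hi => ?_, fun β' hβ' => ?_, fun β' hβ' => ?_⟩
    · rw [hBd0] at hi; omega
    · omega
    · omega
  | succ β ih =>
    intro hβn
    have hβ : β < n := Nat.lt_of_succ_le hβn
    obtain ⟨hb0, hS, hcl⟩ := ih hβ.le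
    set B := Bd β with hBdef
    set L := Bd (β + 1) - Bd β with hLdef
    have hBL : Bd (β + 1) = B + L := by have := hBd β; omega
    -- the far load entering block β is within budget
    have hfarload : ∑ i ∈ range (Bd β), θfar β i * b (Bd β) i ≤ Λ β := by
      -- cut the far range into the earlier blocks
      have hcut : ∑ i ∈ range (Bd β), θfar β i * b (Bd β) i =
          ∑ β' ∈ range β, ∑ i ∈ Ico (Bd β') (Bd (β' + 1)), θfar β i * b (Bd β) i := by
        have key : ∀ k, k ≤ β → ∑ i ∈ range (Bd k), θfar β i * b (Bd β) i =
            ∑ β' ∈ range k, ∑ i ∈ Ico (Bd β') (Bd (β' + 1)), θfar β i * b (Bd β) i := by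
          intro k
          induction k with
          | zero => intro _; simp [hBd0]
          | succ k ihk =>
            intro hk
            rw [sum_range_succ, ← ihk (Nat.le_of_succ_le hk), ← sum_range_add_sum_Ico _ (hBd k)]
        exact key β le_rfl
      rw [hcut]
      refine le_trans (sum_le_sum fun β' hβ' => ?_) (hΛ β hβ)
      have hβ'β : β' < β := mem_range.mp hβ'
      calc ∑ i ∈ Ico (Bd β') (Bd (β' + 1)), θfar β i * b (Bd β) i
          ≤ ∑ i ∈ Ico (Bd β') (Bd (β' + 1)), Θbar β β' * b (Bd β) i :=
            sum_le_sum fun i hi => by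
              have hi' := mem_Ico.mp hi
              have hiB : i < Bd β := lt_of_lt_of_le hi'.2 (hBdmono (β' + 1) β hβ'β)
              exact mul_le_mul_of_nonneg_right (hΘ β β' i hβ'β hi'.1 hi'.2) (hb0 i hiB)
        _ = Θbar β β' * ∑ i ∈ Ico (Bd β') (Bd (β' + 1)), b (Bd β) i := by rw [mul_sum]
        _ ≤ Θbar β β' * ((F β' - 1) * ∏ β'' ∈ Ico (β' + 1) β, F β'') :=
            mul_le_mul_of_nonneg_left (hS β' hβ'β) (hΘbar0 β β')
    obtain ⟨hρblk, hEF⟩ := hstep β hβ hb0 hfarload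
    -- compounding of block β
    set E := ∏ j ∈ range L, (1 - ρ (B + j))⁻¹ with hEdef
    have hE1 : 1 ≤ E := by
      have : ∀ j ∈ range L, (1:ℝ) ≤ (1 - ρ (B + j))⁻¹ := fun j hj => by
        have h := hρblk j (mem_range.mp hj)
        rw [le_inv_comm₀ one_pos (by linarith [h.2]), inv_one]; linarith [h.1]
      calc (1:ℝ) = ∏ j ∈ range L, (1:ℝ) := by simp
        _ ≤ E := prod_le_prod (fun _ _ => zero_le_one) this
    have hE0 : 0 ≤ E := zero_le_one.trans hE1
    refine ⟨fun i hi => ?_, fun β' hβ' => ?_, fun β' hβ' => ?_⟩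
    · -- non-negativity of the carried ratios entering block β+1
      rw [hBL] at hi ⊢
      by_cases hiB : i < B
      · rw [carried_far_factor hold B hiB L]; exact mul_nonneg (hb0 i hiB) hE0
      · obtain ⟨i', rfl⟩ : ∃ i', i = B + i' := ⟨i - B, by omega⟩
        exact block_carried_nonneg hnew hold B L (fun m hm => (hρblk m hm).1) (fun m hm => (hρblk m hm).2) i' (by omega)
    · -- block sums at the start of block β+1
      rw [hBL]
      rcases Nat.lt_succ_iff_lt_or_eq.mp hβ' with hlt | heq
      · -- an earlier block: multiply by E ≤ F β
        have hfac := block_sum_far_factor hold B L (s := Ico (Bd β') (Bd (β' + 1)))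
          (fun i hi => lt_of_lt_of_le (mem_Ico.mp hi).2 (hBdmono (β' + 1) β hlt))
        rw [hfac, prod_Ico_succ_top (by omega : β' + 1 ≤ β), ← mul_assoc]
        have hSnn : 0 ≤ ∑ i ∈ Ico (Bd β') (Bd (β' + 1)), b B i :=
          sum_nonneg fun i hi => hb0 i (lt_of_lt_of_le (mem_Ico.mp hi).2 (hBdmono (β' + 1) β hlt))
        have hM0 : 0 ≤ (F β' - 1) * ∏ β'' ∈ Ico (β' + 1) β, F β'' :=
          mul_nonneg (by linarith [hF1 β']) (prod_nonneg fun β'' _ => zero_le_one.trans (hF1 β''))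
        calc (∑ i ∈ Ico (Bd β') (Bd (β' + 1)), b B i) * E
            ≤ ((F β' - 1) * ∏ β'' ∈ Ico (β' + 1) β, F β'') * E := mul_le_mul_of_nonneg_right (hS β' hlt) hE0
          _ ≤ ((F β' - 1) * ∏ β'' ∈ Ico (β' + 1) β, F β'') * F β := mul_le_mul_of_nonneg_left hEF hM0
      · -- the block just processed: own mass E − 1 ≤ F β − 1
        rw [heq, Ico_self, prod_empty, mul_one, ← hBdef, hBL]
        have hsum : ∑ i ∈ Ico B (B + L), b (B + L) i = ∑ i' ∈ range L, b (B + L) (B + i') := by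
          rw [range_eq_Ico, sum_Ico_add (fun i => b (B + L) i) 0 L B, zero_add, add_comm L B]
        have hρne : ∀ j, j < L → ρ (B + j) ≠ 1 := fun j hj => ((hρblk j hj).2).ne
        rw [hsum, sum_congr rfl fun i' hi' => block_beta_reindex hnew hold B (mem_range.mp hi'),
          sum_rho_mul_compounding hρne]
        linarith
    · -- closure of every member so far
      rcases Nat.lt_succ_iff_lt_or_eq.mp hβ' with hlt | heq
      · exact hcl β' hlt
      · subst heq; exact fun m hm => (hρblk m hm).2

/-! ## §5 (appended, same generation) The young age's read-out of the bin chain -/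

/-- **THE YOUNG'S READ-OUT.**  After the last block (index `M = Bd n`), a young age below the window with defects `θz i` towards the window's ages, bounded
block-constantly by `ϑ β' ≥ θz i` on block `β'` (worst = bottom of the bin, (E72c) `thetabar_antitone`), reads the chain load
`Σ_{i<M} θz_i·b_{M,i} ≤ Σ_{β'<n} ϑ β'·(F β' − 1)·Π_{β'<β''<n} F β''` — given the conclusions of `bin_chain` at `β = n` (carried ratios `≥ 0`, block masses below
the majorant masses).  With (E74b)'s outer charges for the young's maximal load this is the functional Φ of README g64/e73 §4 ∕ g65/e74 §4, now theorem-backed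
end to end on the compounding side. [folklore] -/
theorem young_read_out_le {b : ℕ → ℕ → ℝ} {Bd : ℕ → ℕ} {n : ℕ} {F ϑ θz : ℕ → ℝ}
    (hBd0 : Bd 0 = 0) (hBd : ∀ β, Bd β ≤ Bd (β + 1)) (hϑ0 : ∀ β', 0 ≤ ϑ β')
    (hθz : ∀ β' i, β' < n → Bd β' ≤ i → i < Bd (β' + 1) → θz i ≤ ϑ β')
    (hb0 : ∀ i, i < Bd n → 0 ≤ b (Bd n) i)
    (hS : ∀ β', β' < n → ∑ i ∈ Ico (Bd β') (Bd (β' + 1)), b (Bd n) i ≤ (F β' - 1) * ∏ β'' ∈ Ico (β' + 1) n, F β'') :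
    ∑ i ∈ range (Bd n), θz i * b (Bd n) i ≤ ∑ β' ∈ range n, ϑ β' * ((F β' - 1) * ∏ β'' ∈ Ico (β' + 1) n, F β'') := by
  have hBdmono : ∀ β' β, β' ≤ β → Bd β' ≤ Bd β := fun β' β hle => monotone_nat_of_le_succ hBd hle
  have key : ∀ k, k ≤ n → ∑ i ∈ range (Bd k), θz i * b (Bd n) i =
      ∑ β' ∈ range k, ∑ i ∈ Ico (Bd β') (Bd (β' + 1)), θz i * b (Bd n) i := by
    intro k
    induction k with
    | zero => intro _; simp [hBd0]
    | succ k ihk =>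
      intro hk
      rw [sum_range_succ, ← ihk (Nat.le_of_succ_le hk), ← sum_range_add_sum_Ico _ (hBd k)]
  rw [key n le_rfl]
  refine sum_le_sum fun β' hβ' => ?_
  have hβ'n : β' < n := mem_range.mp hβ'
  calc ∑ i ∈ Ico (Bd β') (Bd (β' + 1)), θz i * b (Bd n) i
      ≤ ∑ i ∈ Ico (Bd β') (Bd (β' + 1)), ϑ β' * b (Bd n) i :=
        sum_le_sum fun i hi => by
          have hi' := mem_Ico.mp hi
          exact mul_le_mul_of_nonneg_right (hθz β' i hβ'n hi'.1 hi'.2) (hb0 i (lt_of_lt_of_le hi'.2 (hBdmono (β' + 1) n hβ'n)))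
    _ = ϑ β' * ∑ i ∈ Ico (Bd β') (Bd (β' + 1)), b (Bd n) i := by rw [mul_sum]
    _ ≤ ϑ β' * ((F β' - 1) * ∏ β'' ∈ Ico (β' + 1) n, F β'') := mul_le_mul_of_nonneg_left (hS β' hβ'n) (hϑ0 β')

/-! ## §6 (appended, same generation) Instantiating the block hypotheses for the WINDOW-MASS chain -/
/-- **WINDOW MASS OF A BLOCK MEMBER = INCOMING + CONSUMED.**  Ages `a_i > 0` oldest first (non-increasing), loads `x_i ≥ 0`: `Σ_{i<B+m} x_i(a_{B+m}∕a_i) ≤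
a_B·Σ_{i<B} x_i∕a_i + Σ_{i<m} x_{B+i}` (far part at the block's oldest age, in-block weights `≤ 1`) — `hΩ` of `block_le_closed_form` with `κ = 1` ((E74a)). [folklore] -/
theorem window_mass_block_le {a x : ℕ → ℝ} (ha0 : ∀ i, 0 < a i) (hmono : ∀ i j, i ≤ j → a j ≤ a i) (hx : ∀ i, 0 ≤ x i) (B m : ℕ) :
    ∑ i ∈ range (B + m), x i * (a (B + m) / a i) ≤ a B * ∑ i ∈ range B, x i / a i + ∑ i ∈ range m, x (B + i) := by
  rw [← sum_range_add_sum_Ico _ (Nat.le_add_right B m), mul_sum]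
  have hfar : ∑ i ∈ range B, x i * (a (B + m) / a i) ≤ ∑ i ∈ range B, a B * (x i / a i) := sum_le_sum fun i _ => by
    rw [mul_div_assoc', mul_div_assoc', mul_comm (a B)]
    exact div_le_div_of_nonneg_right (mul_le_mul_of_nonneg_left (hmono B (B + m) (Nat.le_add_right B m)) (hx i)) (ha0 i).le
  have hblk : ∑ i ∈ Ico B (B + m), x i * (a (B + m) / a i) ≤ ∑ i ∈ range m, x (B + i) := by
    rw [range_eq_Ico, sum_Ico_add (fun i => x i) 0 m B, zero_add, add_comm m B]
    refine sum_le_sum fun i hi => ?_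
    have hle : a (B + m) / a i ≤ 1 := by rw [div_le_one (ha0 i)]; exact hmono i (B + m) (by have := (mem_Ico.mp hi).2; omega)
    simpa using mul_le_mul_of_nonneg_left hle (hx i)
  linarith

/-- The `(1 − ·)` orientation of `block_le_closed_form`'s `hΩ` for the undamped window mass `Ω_{B+m} ≤ Σ_{i<B+m} x_i(a_{B+m}∕a_i)` ((E74a)). [folklore] -/
theorem window_mass_block_hyp {a x Ω : ℕ → ℝ} (ha0 : ∀ i, 0 < a i) (hmono : ∀ i j, i ≤ j → a j ≤ a i) (hx : ∀ i, 0 ≤ x i) (B m : ℕ)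
    (hΩ : Ω (B + m) ≤ ∑ i ∈ range (B + m), x i * (a (B + m) / a i)) :
    (1 - a B * ∑ i ∈ range B, x i / a i) - 1 * ∑ i ∈ range m, x (B + i) ≤ 1 - Ω (B + m) := by
  linarith [window_mass_block_le ha0 hmono hx B m]

end Summit.QuantumFields.BalabanUV.Beta.EriceRemainderEnclosureHistoryAutonomyComparisonAgeCompositionStaticChainBlockFluid

end
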